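import Summits.AtomisticToContinuum.HydrodynamicLimit.Theorems.RelayRaceLocalityConeLocalisationLocalDefs
import HarnessLib

/-!
# RelayRaceLocality · ConeLocalisation — bubble stub: the five analytic inputs as typed `Prop`s

Definitions file for the lead-held stub `stub_bubble : BubbleAtScale` of line `Sketch` (zoomed-bubble-transplant) of
the crux item `stmt-AtomisticToContinuum-12504` (`ConeLocalisation`), lead prover-line-stmt-AtomisticToContinuum-12504-0
(2026-08-17). The bubble lemma is assembled (`…BubbleAssembly*.lean`: bootstrap a-priori estimate + existence) from five
analytic inputs, typed here so that the assembly and the files DISCHARGING them share one set of names: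

* `ZoomHyp` — hyperbolic zoom covariance of compactly supported bubbles on `𝕋³` (a zoom map `Zpt` with the distance
  identity, surjectivity onto `B(x₀, 1/(2m))`, the function-level derivative dictionary, and covariance of
  `IsHardSphereEulerSolution` under `(s, y) ↦ (s/m, Zpt y)`);
* `ReadoutHyp` — σ-uniform drift bounds read off the primitive equations, and the derivative-only Sobolev read-out
  `(∂f)² ≤ K_S · fieldD3 f`;
* `EnergyHyp` — the HOMOGENEOUS derivative-only level-3 energy inequality with σ-uniform constants
  (`D3 t ≤ C_H · D3 0` in a `1/(4M)`-box round a constant state with first derivatives `≤ 1`, horizon `≤ 1`);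
* `SupportHyp` — support preservation against a constant state (= `Bubble.support_preservation`, p134105, verbatim);
* `ExistenceHyp` — existence on a prescribed horizon from a-priori bounds (= `Bubble.exists_of_apriori_bounds`,
  p134517, verbatim);
together with the nested-sum derivative energies `fieldD3`, `fieldD3V`, `D3` they are phrased with, and their
non-negativity. `Prop`s, the three energy `def`s and `D3_nonneg` only.
-/

noncomputable section

namespace Summit.AtomisticToContinuum.HydrodynamicLimit.Theorems.ConeLocalisation.Bubble

open Set MeasureTheory
open Literature.MathematicalPhysics.KineticTheory Literature.Analysis.FluidPDE
  Literature.Analysis.FunctionSpaces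
open Summit.AtomisticToContinuum.HydrodynamicLimit.Theorems.ConeLocalisation

/-! ## The three analytic inputs (hypothesis form) -/

/-- INPUT (Z): hyperbolic zoom covariance of compactly supported bubbles (helper PZ). [folklore] -/
@[conjecture] def ZoomHyp : Prop :=
  ∃ ηZ : ℝ, 0 < ηZ ∧ ∀ (x₀ : T3) (m a : ℝ), 1 < m → 0 < a → m * a < 1 / 4 →
  ∃ Zpt : T3 → T3,
    (∀ y, Torus.euclidDist (Zpt y) x₀ = m⁻¹ * Torus.euclidDist y x₀) ∧
    (∀ x, Torus.euclidDist x x₀ < 1 / (2 * m) → ∃ y, Zpt y = x) ∧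
    (∀ (f : T3 → ℝ) (b : ℝ), Torus.IsSmooth f → (∀ x, a ≤ Torus.euclidDist x x₀ → f x = b) →
      Torus.IsSmooth (fun y => f (Zpt y)) ∧
      (∀ y (i : Fin 3), Torus.partialDeriv i (fun y => f (Zpt y)) y = m⁻¹ * Torus.partialDeriv i f (Zpt y)) ∧
      (∀ y, m * a ≤ Torus.euclidDist y x₀ → f (Zpt y) = b)) ∧
    (∀ (w : T3 → V3) (b : V3), Torus.IsSmooth w → (∀ x, a ≤ Torus.euclidDist x x₀ → w x = b) →
      Torus.IsSmooth (fun y => w (Zpt y)) ∧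
      (∀ y (i : Fin 3), Torus.partialDeriv i (fun y => w (Zpt y)) y = m⁻¹ • Torus.partialDeriv i w (Zpt y)) ∧
      (∀ y, m * a ≤ Torus.euclidDist y x₀ → w (Zpt y) = b)) ∧
    (∀ (σ T : ℝ) (ρ θ : ℝ → T3 → ℝ) (u : ℝ → T3 → V3), IsHardSphereEulerSolution σ T ρ u θ →
      ∀ (ρbar θbar : ℝ) (ubar : V3),
      (∀ t ∈ Ico 0 T, ∀ x, a ≤ Torus.euclidDist x x₀ → ρ t x = ρbar ∧ θ t x = θbar ∧ u t x = ubar) →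
      (∀ t ∈ Ico 0 T, ∀ x, ρ t x * σ ^ 3 ≤ ηZ) →
      IsHardSphereEulerSolution σ (m * T) (fun s y => ρ (s / m) (Zpt y)) (fun s y => u (s / m) (Zpt y))
        (fun s y => θ (s / m) (Zpt y)))

/-- INPUT (D): support preservation (= `Bubble.support_preservation`, p134105, verbatim). [cite: Dafermos2005, Thm 5.2.1] -/
@[conjecture] def SupportHyp : Prop :=
    ∃ ηD : ℝ, 0 < ηD ∧ ∀ M : ℝ, 0 < M → ∃ c : ℝ, 0 < c ∧
      ∀ σ : ℝ, 0 < σ → ∀ (T : ℝ) (ρ θ : ℝ → T3 → ℝ) (u : ℝ → T3 → V3),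
        IsHardSphereEulerSolution σ T ρ u θ →
      ∀ (ρbar θbar : ℝ) (ubar : V3), 0 < ρbar → 0 < θbar → ρbar * σ ^ 3 < ηD → θbar ≤ M → ‖ubar‖ ≤ M →
      ∀ t : ℝ, 0 ≤ t → t < T →
        (∀ s ∈ Set.Icc 0 t, ∀ x, ρ s x * σ ^ 3 < ηD ∧ θ s x ≤ M ∧ ‖u s x‖ ≤ M) →
      ∀ (x₀ : T3) (a : ℝ),
        (∀ x, a ≤ Torus.euclidDist x x₀ → ρ 0 x = ρbar ∧ u 0 x = ubar ∧ θ 0 x = θbar) →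
      ∀ x, a + c * t < Torus.euclidDist x x₀ → ρ t x = ρbar ∧ u t x = ubar ∧ θ t x = θbar

/-- INPUT (E): existence from a-priori bounds (= `Bubble.exists_of_apriori_bounds`, p134517, verbatim). [cite: Majda1984, Ch. 2 Thm 2.2] -/
@[conjecture] def ExistenceHyp : Prop :=
    ∃ ηE : ℝ, 0 < ηE ∧ ∀ σ : ℝ, 0 < σ → ∀ (T' Mb : ℝ), 0 < T' → 0 < Mb →
      ∀ (ρ₀ θ₀ : T3 → ℝ) (u₀ : T3 → V3), Torus.IsSmooth ρ₀ → Torus.IsSmooth θ₀ → Torus.IsSmooth u₀ →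
      (∀ x, 0 < ρ₀ x) → (∀ x, 0 < θ₀ x) → (∀ x, ρ₀ x * σ ^ 3 ≤ ηE) →
      (∀ T : ℝ, T ≤ T' → ∀ (ρ θ : ℝ → T3 → ℝ) (u : ℝ → T3 → V3), IsHardSphereEulerSolution σ T ρ u θ →
        ρ 0 = ρ₀ → u 0 = u₀ → θ 0 = θ₀ →
        ∀ t ∈ Ico 0 T, ∀ x, Mb⁻¹ ≤ ρ t x ∧ ρ t x ≤ Mb ∧ Mb⁻¹ ≤ θ t x ∧ θ t x ≤ Mb ∧ ‖u t x‖ ≤ Mb ∧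
          ρ t x * σ ^ 3 ≤ ηE ∧
          ∀ i : Fin 3, ‖Torus.partialDeriv i (u t) x‖ ≤ Mb ∧ |Torus.partialDeriv i (ρ t) x| ≤ Mb ∧
            |Torus.partialDeriv i (θ t) x| ≤ Mb) →
      ∃ (ρ θ : ℝ → T3 → ℝ) (u : ℝ → T3 → V3),
        IsHardSphereEulerSolution σ T' ρ u θ ∧ ρ 0 = ρ₀ ∧ u 0 = u₀ ∧ θ 0 = θ₀

/-- The derivative-only order-1..3 energy of one scalar slice (nested-sum form). [folklore] -/
def fieldD3 (f : T3 → ℝ) : ℝ :=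
  (∑ l : Fin 3, ∫ y, Torus.partialDeriv l f y ^ 2) +
    (∑ i : Fin 3, ∑ l : Fin 3, ∫ y, Torus.partialDeriv i (Torus.partialDeriv l f) y ^ 2) +
    ∑ j : Fin 3, ∑ i : Fin 3, ∑ l : Fin 3,
      ∫ y, Torus.partialDeriv j (Torus.partialDeriv i (Torus.partialDeriv l f)) y ^ 2

/-- The same for a vector slice. [folklore] -/
def fieldD3V (w : T3 → V3) : ℝ :=
  (∑ l : Fin 3, ∫ y, ‖Torus.partialDeriv l w y‖ ^ 2) +
    (∑ i : Fin 3, ∑ l : Fin 3, ∫ y, ‖Torus.partialDeriv i (Torus.partialDeriv l w) y‖ ^ 2) +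
    ∑ j : Fin 3, ∑ i : Fin 3, ∑ l : Fin 3,
      ∫ y, ‖Torus.partialDeriv j (Torus.partialDeriv i (Torus.partialDeriv l w)) y‖ ^ 2

/-- The derivative-only order-1..3 energy of the triple `(ρ, u, θ)` at time `t`. [folklore] -/
def D3 (ρ : ℝ → T3 → ℝ) (u : ℝ → T3 → V3) (θ : ℝ → T3 → ℝ) (t : ℝ) : ℝ :=
  fieldD3 (ρ t) + fieldD3V (u t) + fieldD3 (θ t)

/-- `fieldD3 f ≥ 0` (sums of integrals of squares). [folklore] -/
theorem fieldD3_nonneg (f : T3 → ℝ) : 0 ≤ fieldD3 f := by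
  unfold fieldD3
  refine add_nonneg (add_nonneg ?_ ?_) ?_
  · exact Finset.sum_nonneg fun _ _ => integral_nonneg fun _ => sq_nonneg _
  · exact Finset.sum_nonneg fun _ _ => Finset.sum_nonneg fun _ _ => integral_nonneg fun _ => sq_nonneg _
  · exact Finset.sum_nonneg fun _ _ => Finset.sum_nonneg fun _ _ => Finset.sum_nonneg fun _ _ =>
      integral_nonneg fun _ => sq_nonneg _

/-- `fieldD3V w ≥ 0`. [folklore] -/
theorem fieldD3V_nonneg (w : T3 → V3) : 0 ≤ fieldD3V w := by
  unfold fieldD3V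
  refine add_nonneg (add_nonneg ?_ ?_) ?_
  · exact Finset.sum_nonneg fun _ _ => integral_nonneg fun _ => sq_nonneg _
  · exact Finset.sum_nonneg fun _ _ => Finset.sum_nonneg fun _ _ => integral_nonneg fun _ => sq_nonneg _
  · exact Finset.sum_nonneg fun _ _ => Finset.sum_nonneg fun _ _ => Finset.sum_nonneg fun _ _ =>
      integral_nonneg fun _ => sq_nonneg _

/-- `D3 ρ u θ t ≥ 0`. [folklore] -/
theorem D3_nonneg (ρ : ℝ → T3 → ℝ) (u : ℝ → T3 → V3) (θ : ℝ → T3 → ℝ) (t : ℝ) : 0 ≤ D3 ρ u θ t :=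
  add_nonneg (add_nonneg (fieldD3_nonneg _) (fieldD3V_nonneg _)) (fieldD3_nonneg _)

/-- INPUT (T): drift bounds (primitive equations) and the derivative-only Sobolev read-out (helper PC0). [folklore] -/
@[conjecture] def ReadoutHyp : Prop :=
  (∃ ηT : ℝ, 0 < ηT ∧ ∀ M : ℝ, 0 < M → ∃ CT : ℝ, 0 < CT ∧ ∀ σ : ℝ, 0 < σ →
    ∀ (T : ℝ) (ρ θ : ℝ → T3 → ℝ) (u : ℝ → T3 → V3), IsHardSphereEulerSolution σ T ρ u θ →
    ∀ t ∈ Ico 0 T, ∀ A : ℝ, 0 ≤ A →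
    (∀ s ∈ Icc 0 t, ∀ x, M⁻¹ ≤ ρ s x ∧ ρ s x ≤ M ∧ M⁻¹ ≤ θ s x ∧ θ s x ≤ M ∧ ‖u s x‖ ≤ M ∧
      ρ s x * σ ^ 3 ≤ ηT ∧ ∀ i : Fin 3, |Torus.partialDeriv i (ρ s) x| ≤ A ∧
      ‖Torus.partialDeriv i (u s) x‖ ≤ A ∧ |Torus.partialDeriv i (θ s) x| ≤ A) →
    ∀ x, |ρ t x - ρ 0 x| ≤ CT * A * t ∧ ‖u t x - u 0 x‖ ≤ CT * A * t ∧ |θ t x - θ 0 x| ≤ CT * A * t) ∧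
  (∃ KS : ℝ, 0 < KS ∧
    (∀ f : T3 → ℝ, Torus.IsSmooth f → ∀ (x : T3) (l : Fin 3), Torus.partialDeriv l f x ^ 2 ≤ KS * fieldD3 f) ∧
    (∀ w : T3 → V3, Torus.IsSmooth w → ∀ (x : T3) (l : Fin 3), ‖Torus.partialDeriv l w x‖ ^ 2 ≤ KS * fieldD3V w))

/-- INPUT (H): homogeneous derivative-only level-3 energy inequality, σ-uniform (helper H). [cite: Majda1984, Ch. 2 Thm 2.2] -/
@[conjecture] def EnergyHyp : Prop :=
  ∃ ηH : ℝ, 0 < ηH ∧ ∀ M : ℝ, 1 ≤ M → ∃ CH : ℝ, 1 ≤ CH ∧ ∀ σ : ℝ, 0 < σ →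
    ∀ (ρbar θbar : ℝ) (ubar : V3), M⁻¹ ≤ ρbar → ρbar ≤ M → M⁻¹ ≤ θbar → θbar ≤ M → ‖ubar‖ ≤ M →
    ρbar * σ ^ 3 ≤ ηH →
    ∀ T : ℝ, 0 < T → T ≤ 1 → ∀ (ρ θ : ℝ → T3 → ℝ) (u : ℝ → T3 → V3), IsHardSphereEulerSolution σ T ρ u θ →
    (∀ t ∈ Ico 0 T, ∀ x, |ρ t x - ρbar| ≤ 1 / (4 * M) ∧ |θ t x - θbar| ≤ 1 / (4 * M) ∧
      ‖u t x - ubar‖ ≤ 1 / (4 * M) ∧ ∀ i : Fin 3, |Torus.partialDeriv i (ρ t) x| ≤ 1 ∧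
      ‖Torus.partialDeriv i (u t) x‖ ≤ 1 ∧ |Torus.partialDeriv i (θ t) x| ≤ 1) →
    ∀ t ∈ Ico 0 T, D3 ρ u θ t ≤ CH * D3 ρ u θ 0

end Summit.AtomisticToContinuum.HydrodynamicLimit.Theorems.ConeLocalisation.Bubble

end
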